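import Mathlib
import Summits.CriticalPhenomena.PercolationContinuityZ3.Theorems.PercNearOneGluingNoHeavyLowerTailHexMSMatchHybrid

/-!
# The hybrid certificate at the (MATCH*) level (hp-7 gen 80)

Support file for crux `stmt-CriticalPhenomena-4575` (route `PercNearOneGluingNoHeavy`), hull-port seat `prim-hp-7` (generation 80);
`--supports stmt-CriticalPhenomena-4575 --as helper`.  No `sorry`.  Memo: `run/shared/lean/prim/prim-hp-7/FROM-prim-hp-7-g80-TWO-DIRECTIONS.md` §4.

* `Hybrid.card_le_card_farNbhd_of_saturated` — Hall's condition for the dead set of every depth-one saturated two-class antipodal instance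
  (dead labels in `{i, i+1, i+3, i+4}`, alive members = blockers of labels `i+5`, `i+2`) whose dead classes `i`, `i+1` are PAIR-SATURATED:
  for all dead `p`, `q` of labels `i`, `i+1`, `p \ q ∈ 𝒟` or `p ∪ (U \ q) ∈ 𝒟`.  The side conditions of
  `Hybrid.two_mul_card_le_card_clU_scTerms_of_saturated` (`w ⊄ q`: labels `i+5`, `i+1` far; `p ∪ w ≠ U`: labels `i`, `i+5` close; purity;
  forced labels of the two blockers) follow from deadness exactly as in `…HexMSMatchCommonElementBridge`.
-/

namespace Summit.CriticalPhenomena.PercolationContinuityZ3.Theorems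

namespace Hybrid

open Finset GeneratedDonors
open scoped FinsetFamily

variable {α : Type*} [DecidableEq α] {U : Finset α}

section DepthOne

variable {𝒟 : Finset (Finset α)} {x : Finset α → ZMod 6}

/-- **(MATCH*) for pair-saturated depth-one two-class instances** (hp-7 gen 80): as `card_le_card_farNbhd_of_ms2At`, for antipodal
instances whose dead members carry labels in `{i, i+1, i+3, i+4}` and whose alive members are depth-one blockers, assuming that every pair
`(p, q)` of dead members of labels `i`, `i+1` is blocked in some direction (`p \ q ∈ 𝒟` or `p ∪ (U \ q) ∈ 𝒟`).  Then Hall's condition holds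
for the dead set: `#𝒟 ≤ #(farNbhd 𝒟 x (dead U 𝒟 x))`.  The side conditions of the hybrid certificate follow from deadness. -/
theorem card_le_card_farNbhd_of_saturated (hU : ∀ a ∈ 𝒟, a ⊆ U) (hco : ∀ a ∈ 𝒟, U \ a ∈ 𝒟)
    (hanti : ∀ a ∈ 𝒟, x (U \ a) = x a + 3) (i : ZMod 6)
    (hlab : ∀ a ∈ dead U 𝒟 x, x a = i ∨ x a = i + 1 ∨ x a = i + 3 ∨ x a = i + 4)
    (hdepth : ∀ d ∈ 𝒟, d ∉ dead U 𝒟 x →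
      (x d = i + 5 ∧ d ∈ scReps U ((dead U 𝒟 x).filter fun a => x a = i) ((dead U 𝒟 x).filter fun a => x a = i + 1)) ∨
      (x d = i + 2 ∧ U \ d ∈ scReps U ((dead U 𝒟 x).filter fun a => x a = i) ((dead U 𝒟 x).filter fun a => x a = i + 1)))
    (hsat : ∀ p ∈ dead U 𝒟 x, ∀ q ∈ dead U 𝒟 x, x p = i → x q = i + 1 → p \ q ∈ 𝒟 ∨ p ∪ (U \ q) ∈ 𝒟) :
    #𝒟 ≤ #(farNbhd 𝒟 x (dead U 𝒟 x)) := by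
  classical
  obtain ⟨n01, n30, n31, n40, n41, n85, n50, n51, n20, n21, n25, n53, n54, e33, e43, e23⟩ := label_facts i
  set P : Finset (Finset α) := (dead U 𝒟 x).filter fun a => x a = i with hPdef
  set Q : Finset (Finset α) := (dead U 𝒟 x).filter fun a => x a = i + 1 with hQdef
  set W : Finset (Finset α) := (𝒟 \ dead U 𝒟 x).filter fun a => x a = i + 5 with hWdef
  have hP : ∀ p ∈ P, p ∈ dead U 𝒟 x ∧ x p = i := fun p hp => by
    have h := mem_filter.mp hp; exact ⟨h.1, h.2⟩
  have hQ : ∀ q ∈ Q, q ∈ dead U 𝒟 x ∧ x q = i + 1 := fun q hq => by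
    have h := mem_filter.mp hq; exact ⟨h.1, h.2⟩
  have hW : ∀ w ∈ W, (w ∈ 𝒟 ∧ w ∉ dead U 𝒟 x) ∧ x w = i + 5 := fun w hw => by
    have h := mem_filter.mp hw; exact ⟨mem_sdiff.mp h.1, h.2⟩
  have hdD : ∀ {a}, a ∈ dead U 𝒟 x → a ∈ 𝒟 := fun ha => (mem_filter.mp ha).1
  have hcc : ∀ {a}, a ⊆ U → U \ (U \ a) = a := fun ha => Finset.sdiff_sdiff_eq_self ha
  have h1 : ∀ a ∈ P ∪ Q, a ⊆ U := by
    intro a ha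
    rcases mem_union.mp ha with ha | ha
    · exact hU a (hdD (hP a ha).1)
    · exact hU a (hdD (hQ a ha).1)
  have hPQlab : ∀ a ∈ P ∪ Q, a ∈ dead U 𝒟 x ∧ (x a = i ∨ x a = i + 1) := by
    intro a ha
    rcases mem_union.mp ha with ha | ha
    · exact ⟨(hP a ha).1, Or.inl (hP a ha).2⟩
    · exact ⟨(hQ a ha).1, Or.inr (hQ a ha).2⟩
  have hint : ∀ a ∈ P ∪ Q, ∀ b ∈ P ∪ Q, (a ∩ b).Nonempty := fun a ha b hb =>
    inter_nonempty_of_dead_of_close (hPQlab a ha).1 (hdD (hPQlab b hb).1)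
      (close_of_mem_pair (hPQlab a ha).2 (hPQlab b hb).2)
  have hcov : ∀ a ∈ P ∪ Q, ∀ b ∈ P ∪ Q, a ∪ b ≠ U := fun a ha b hb =>
    union_ne_of_dead_of_close hU hco hanti (hPQlab a ha).1 (hdD (hPQlab b hb).1)
      (close_of_mem_pair (hPQlab a ha).2 (hPQlab b hb).2)
  have h4 : W ⊆ scReps U P Q := by
    intro w hw
    obtain ⟨⟨hwD, hwa⟩, hxw⟩ := hW w hw
    rcases hdepth w hwD hwa with ⟨-, h⟩ | ⟨h2', -⟩
    · exact h
    · exact absurd (hxw.symm.trans h2') n25.symm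
  have h5 : ∀ a ∈ W, ∀ b ∈ W, a ≠ U \ b := by
    intro a ha b hb hab
    have hxa := (hW a ha).2
    have hxb : x a = x b + 3 := by rw [hab]; exact hanti b (hW b hb).1.1
    rw [(hW b hb).2] at hxb
    exact n85 (hxb.symm.trans hxa)
  have h6 : ∀ w ∈ W, w ∉ clU U ((P \\ P) ∪ (Q \\ Q)) := by
    intro w hw hmem
    obtain ⟨⟨hwD, -⟩, -⟩ := hW w hw
    have key : ∀ t ∈ (P \\ P) ∪ (Q \\ Q), t ∉ 𝒟 ∧ t ⊆ U := by
      intro t ht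
      rcases mem_union.mp ht with ht | ht
      · obtain ⟨a, ha, b, hb, rfl⟩ := mem_diffs.mp ht
        have hda := hP a ha; have hdb := hP b hb
        refine ⟨(sdiff_notMem_of_dead_of_label_eq hU hco hanti (hdD hda.1) (hdD hdb.1) (mem_filter.mp hda.1).2
          (mem_filter.mp hdb.1).2 (hda.2.trans hdb.2.symm)).2, sdiff_subset.trans (hU a (hdD hda.1))⟩
      · obtain ⟨a, ha, b, hb, rfl⟩ := mem_diffs.mp ht
        have hda := hQ a ha; have hdb := hQ b hb
        refine ⟨(sdiff_notMem_of_dead_of_label_eq hU hco hanti (hdD hda.1) (hdD hdb.1) (mem_filter.mp hda.1).2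
          (mem_filter.mp hdb.1).2 (hda.2.trans hdb.2.symm)).2, sdiff_subset.trans (hU a (hdD hda.1))⟩
    rcases mem_clU.mp hmem with h | ⟨t, ht, rfl⟩
    · exact (key w h).1 hwD
    · have := hco _ hwD
      rw [hcc (key t ht).2] at this
      exact (key t ht).1 this
  -- close labels `i`, `i+5`: no covering pair; far labels `i+1`, `i+5`: no containment
  have hX2W : ∀ p ∈ P, ∀ w ∈ W, p ∪ w ≠ U := by
    intro p hp w hw
    have hcl : Close (x p) (x w) := by
      rw [(hP p hp).2, (hW w hw).2]
      unfold Close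
      right; left
      have h6 : (5 : ZMod 6) + 1 = 0 := by decide
      rw [add_assoc, h6, add_zero]
    exact union_ne_of_dead_of_close hU hco hanti (hP p hp).1 (hW w hw).1.1 hcl
  have hX1W : ∀ w ∈ W, ∀ q ∈ Q, ¬ w ⊆ q := by
    intro w hw q hq
    have hfar : ¬ Close (x w) (x q) := by
      rw [(hW w hw).2, (hQ q hq).2]
      have : ∀ j : ZMod 6, ¬ Close (j + 5) (j + 1) := by decide
      exact this i
    exact not_subset_of_dead_of_not_close hU hco hanti (hQ q hq).1 (hW w hw).1.1 hfar
  have hsat' : ∀ p ∈ P, ∀ q ∈ Q, p \ q ∈ W ∨ p ∪ (U \ q) ∈ W := by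
    intro p hp q hq
    have hpd := hP p hp; have hqd := hQ q hq
    -- labels of the two candidate blockers are forced
    rcases hsat p hpd.1 q hqd.1 hpd.2 hqd.2 with h | h
    · left
      have hlab5 : x (p \ q) = i + 5 := by
        rw [← hpd.2]; exact label_sdiff_of_dead_adjacent hU hco hanti hpd.1 hqd.1 (by rw [hpd.2, hqd.2]) h
      have halive : p \ q ∉ dead U 𝒟 x := by
        intro hdead
        rcases hlab _ hdead with h' | h' | h' | h'
        · exact n50 (hlab5.symm.trans h')
        · exact n51 (hlab5.symm.trans h')
        · exact n53 (hlab5.symm.trans h')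
        · exact n54 (hlab5.symm.trans h')
      exact mem_filter.mpr ⟨mem_sdiff.mpr ⟨h, halive⟩, hlab5⟩
    · right
      -- `U \ (p ∪ (U \ q)) = q \ p ∈ 𝒟` has label `x p + 2`, so `p ∪ (U \ q)` has label `x p + 5`
      have hmem' : q \ p ∈ 𝒟 := by
        have e : U \ (p ∪ (U \ q)) = q \ p := by
          ext j; simp only [mem_sdiff, mem_union, not_or, not_and, not_not]
          constructor
          · rintro ⟨hjU, hjp, hj⟩; exact ⟨hj hjU, hjp⟩
          · rintro ⟨hjq, hjp⟩; exact ⟨hU q (hdD hqd.1) hjq, hjp, fun _ => hjq⟩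
        rw [← e]; exact hco _ h
      have hlab2 : x (q \ p) = i + 2 := by
        rw [← hpd.2]; exact label_sdiff_of_dead_adjacent' hU hco hanti hpd.1 hqd.1 (by rw [hpd.2, hqd.2]) hmem'
      have hwU : p ∪ (U \ q) ⊆ U := union_subset (hU p (hdD hpd.1)) sdiff_subset
      have e2 : U \ (q \ p) = p ∪ (U \ q) := by
        have e : U \ (p ∪ (U \ q)) = q \ p := by
          ext j; simp only [mem_sdiff, mem_union, not_or, not_and, not_not]
          constructor
          · rintro ⟨hjU, hjp, hj⟩; exact ⟨hj hjU, hjp⟩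
          · rintro ⟨hjq, hjp⟩; exact ⟨hU q (hdD hqd.1) hjq, hjp, fun _ => hjq⟩
        rw [← e, hcc hwU]
      have hlab5 : x (p ∪ (U \ q)) = i + 5 := by
        rw [← e2, hanti _ hmem', hlab2]; ring
      have halive : p ∪ (U \ q) ∉ dead U 𝒟 x := by
        intro hdead
        rcases hlab _ hdead with h' | h' | h' | h'
        · exact n50 (hlab5.symm.trans h')
        · exact n51 (hlab5.symm.trans h')
        · exact n53 (hlab5.symm.trans h')
        · exact n54 (hlab5.symm.trans h')
      exact mem_filter.mpr ⟨mem_sdiff.mpr ⟨h, halive⟩, hlab5⟩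
  have hineq : 2 * (#P + #Q + #W) ≤ #(clU U (scTerms P Q W)) :=
    two_mul_card_le_card_clU_scTerms_of_saturated P Q W h1 hint hcov h4 h5 h6 hX1W hX2W hsat'
  have hsub : clU U (scTerms P Q W) ⊆ farNbhd 𝒟 x (dead U 𝒟 x) :=
    clU_scTerms_subset_farNbhd hU hco hanti i hP hQ (fun w hw => ⟨(hW w hw).1.1, (hW w hw).2⟩)
  -- counting 𝒟: every member or its complement lies in P ∪ Q ∪ W
  set A : Finset (Finset α) := 𝒟.filter fun d => x d = i ∨ x d = i + 1 ∨ x d = i + 5 with hAdef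
  set B : Finset (Finset α) := 𝒟.filter fun d => ¬ (x d = i ∨ x d = i + 1 ∨ x d = i + 5) with hBdef
  have hmemPQW : ∀ d ∈ 𝒟, (x d = i ∨ x d = i + 1 ∨ x d = i + 5) → d ∈ P ∪ Q ∪ W := by
    intro d hd hx
    simp only [mem_union]
    by_cases hdead : d ∈ dead U 𝒟 x
    · rcases hx with h | h | h
      · exact Or.inl (Or.inl (mem_filter.mpr ⟨hdead, h⟩))
      · exact Or.inl (Or.inr (mem_filter.mpr ⟨hdead, h⟩))
      · exfalso
        rcases hlab d hdead with h' | h' | h' | h'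
        · exact n50 (h.symm.trans h')
        · exact n51 (h.symm.trans h')
        · exact n53 (h.symm.trans h')
        · exact n54 (h.symm.trans h')
    · rcases hdepth d hd hdead with ⟨h5', -⟩ | ⟨h2', -⟩
      · exact Or.inr (mem_filter.mpr ⟨mem_sdiff.mpr ⟨hd, hdead⟩, h5'⟩)
      · exfalso
        rcases hx with h | h | h
        · exact n20 (h2'.symm.trans h)
        · exact n21 (h2'.symm.trans h)
        · exact n25 (h2'.symm.trans h)
  have hA : A ⊆ P ∪ Q ∪ W := fun d hd => hmemPQW d (mem_filter.mp hd).1 (mem_filter.mp hd).2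
  have hB : B.image (fun d => U \ d) ⊆ P ∪ Q ∪ W := by
    intro e he
    obtain ⟨d, hd, rfl⟩ := mem_image.mp he
    obtain ⟨hdD', hnot⟩ := mem_filter.mp hd
    refine hmemPQW (U \ d) (hco d hdD') ?_
    rw [hanti d hdD']
    by_cases hdead : d ∈ dead U 𝒟 x
    · rcases hlab d hdead with h | h | h | h
      · exact absurd (Or.inl h) hnot
      · exact absurd (Or.inr (Or.inl h)) hnot
      · rw [h]; exact Or.inl e33
      · rw [h]; exact Or.inr (Or.inl e43)
    · rcases hdepth d hdD' hdead with ⟨h5', -⟩ | ⟨h2', -⟩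
      · exact absurd (Or.inr (Or.inr h5')) hnot
      · rw [h2']; exact Or.inr (Or.inr e23)
  have hinjB : Set.InjOn (fun d : Finset α => U \ d) ↑B := by
    intro d hd e he hde
    have hdU : d ⊆ U := hU d (mem_filter.mp (mem_coe.mp hd)).1
    have heU : e ⊆ U := hU e (mem_filter.mp (mem_coe.mp he)).1
    have h1' := congrArg (fun t => U \ t) hde
    simp only [hcc hdU, hcc heU] at h1'
    exact h1'
  have hsplit : #A + #B = #𝒟 := card_filter_add_card_filter_not _
  have hcardA : #A ≤ #(P ∪ Q ∪ W) := card_le_card hA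
  have hcardB : #B ≤ #(P ∪ Q ∪ W) := by
    rw [← card_image_of_injOn hinjB]; exact card_le_card hB
  have hunion : #(P ∪ Q ∪ W) ≤ #P + #Q + #W :=
    (card_union_le _ _).trans (Nat.add_le_add_right (card_union_le _ _) _)
  have hT := card_le_card hsub
  omega

end DepthOne

end Hybrid

end Summit.CriticalPhenomena.PercolationContinuityZ3.Theorems
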